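import Mathlib
import Literature.Barriers.PneNP.TSPExtensionComplexityRectangles
import Literature.Barriers.PneNP.TSPExtensionComplexityFaces
import HarnessLib

/-!
# Fooling sets bound extension complexity; the cube and the Birkhoff polytope are minimal
# extensions of themselves (Fiorini–Kaibel–Pashkovich–Theis 2013, §5.3, Propositions 33 and 34) — PROVED

Source: S. Fiorini, V. Kaibel, K. Pashkovich, D. O. Theis, *Combinatorial bounds on nonnegative rank
and extended formulations*, Discrete Math. 313 (2013) 67–83 = arXiv:1111.0444
[FioriniKaibelPashkovichTheis2013] (held text `paper:arxiv-1111.0444`, arXiv numbering). Verbatim.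
§5.3: "A clique in [the rectangle graph] corresponds to what is known as a fooling set: A selection of
non-zeros in the matrix such that no two of them induce a rectangle contained in supp(M) … the clique
number … [is] a lower bound on the rectangle covering number of `M`" (and `rc ≤ xc`, §2).
§5.3.2: "**Proposition 33.** If `P` is a combinatorial `d`-cube then `xc(P) = 2d`. Proof. We obviously
have `ω(P) ≤ xc(P) ≤ 2d`. … we may assume that `P = [0,1]^d`. … The vertex corresponding to the
inequality `x_i ≥ 0` is the vertex `v_i` defined as follows: `(v_i)_j := 1` if `1 ≤ j ≤ i`, `0` if
`i < j ≤ d`. For the inequality `x_i ≤ 1`, take the vertex `w_i` defined as follows: `(w_i)_j := 0` if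
`1 ≤ j ≤ i`, `1` if `i < j ≤ d`. One can check that none of the facets of the cube is incident with
its corresponding vertex, but that for any two facets at least one of the corresponding vertices is
incident to one of them." §5.3.3: "**Proposition 34.** For `n ≥ 4`, the extension complexity of the
Birkhoff polytope is `n²`. Proof. The Birkhoff polytope `P` is defined by the nonnegativity
inequalities `x_{i,j} ≥ 0`, `i,j ∈ [n]₀ = {0,…,n−1}` …, and the equations `Σ_i x_{i,j} = 1`,
`Σ_j x_{i,j} = 1`. This trivially implies that `xc(P) ≤ n²`. To give a lower bound on the extension
complexity, we construct a fooling set of size `n²` in the facet vs. vertex non-incidence matrix of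
`P`. For this, for every inequality `x_{i,j} ≥ 0`, we define one vertex `v_{i,j}` such that
`(v_{i,j})_{i,j} > 0` by giving a permutation `π` of `[n]₀`. Namely, let `π(i) := j` and
`π(i+1) := j+1` (all indices are to be understood modulo `n`). Moreover, we take `π(k) := i+j+1−k`
whenever `k ∉ {i,i+1}`. … Because `(i,j) ≠ (i',j')`, we conclude that `i+j+1−i' = j'` or
`(i',j') = (i+1,j+1)`, and at the same time `i'+j'+1−i = j` or `(i,j) = (i'+1,j'+1)`. Because `2 ≠ 0`
and `3 ≠ 0` modulo `n`, these conditions lead to a contradiction." §5.3.1: "**Lemma 31.** For every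
polytope `P` of dimension `d`, we have `ω(P) ≤ (d+1)²`. Proof. … Let `z_i := (b_i, −A_i) ∈ ℝ^{d+1}`,
… `t_j := (1, v_j) ∈ ℝ^{d+1}` … `⟨z_i, t_j⟩ ≥ 0` …; `⟨z_i, t_i⟩ > 0` …; `⟨z_i, t_j⟩ = 0` or
`⟨z_j, t_i⟩ = 0` for all `i ≠ j`. Now consider the following `2q` rank-one matrices: `z_i t_iᵀ` … and
`t_j z_jᵀ` …. if `i ≠ j`, we have `⟨z_i t_iᵀ, t_j z_jᵀ⟩ = … = ⟨z_j, t_i⟩⟨z_i, t_j⟩ = 0`, but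
`⟨z_i t_iᵀ, t_i z_iᵀ⟩ = ⟨z_i, t_i⟩⟨z_i, t_i⟩ > 0`. This implies that the matrices `z_1 t_1ᵀ, …, z_q t_qᵀ`
are linearly independent. Since we have `q` linearly independent `(d+1)×(d+1)`-matrices, we conclude
that `q ≤ (d+1)²`."

## What is proved (no named fact), in the tree's slack-form currency `HasEFOfSize` (FMPTW)

* `HasEFOfSize.card_le_of_foolingSet` — **the fooling-set bound**: given points `v_b ∈ P`, valid
  inequalities `c_a · x ≤ d_a`, and a finite set `T` of rows, each tight at some point and equipped
  with a point `w(a)` of positive slack such that for `a ≠ a'` in `T` one of the two cross slacks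
  vanishes, every extended formulation of `P` has size `≥ |T|`. Printed route: `ω ≤ rc ≤ rk₊ = xc`
  (Yannakakis' factorisation theorem); here through the tree's duality-free rectangle cover
  `HasEFOfSize.exists_cover` (`TSPExtensionComplexityRectangles.lean`): each fooling entry lies in
  one of the `r` rectangles, and no rectangle holds two of them;
* **Proposition 33 for `P = [0,1]^d`** (`unitCube d = Set.Icc 0 1 ⊆ ℝ^d`): `hasEFOfSize_unitCube`
  (`xc ≤ 2d`: `x = y`, `x + y' = 1`, `y, y' ≥ 0`) and `FKPT2013_prop33` (`HasEFOfSize (unitCube d) r →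
  2d ≤ r`, the staircase fooling set `v_i`, `w_i`);
  -- TODO(general form): the printed statement covers every COMBINATORIAL `d`-cube (face lattice of
  -- `[0,1]^d`); only the unit cube is typed (the tree has no face-lattice isomorphism notion).
* **Proposition 34**: `birkhoffPolytope α = conv{permutation matrices} ⊆ ℝ^{α×α}` (entries indexed
  by `α × α`), its description by nonnegativity and row/column sums (`mem_birkhoffPolytope_iff`,
  the Birkhoff–von Neumann theorem, Mathlib's `doublyStochastic_eq_convexHull_permMatrix`
  transported along currying), `hasEFOfSize_birkhoffPolytope` (`xc ≤ |α|²`) and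
  `FKPT2013_prop34`: for `n ≥ 4`, `HasEFOfSize (birkhoffPolytope (ZMod n)) r → n² ≤ r`, through the
  printed fooling set `π_{i,j} = swap(j, j+1) ∘ (k ↦ i+j+1−k)` on `ℤ/n` (`foolPerm`).
* **Lemma 31 (the dimension bound on fooling sets)**, ambient form: for ANY rows `(c_a, d_a)` and
  points `v_b` in `ℝ^ι`, a fooling pattern `T` (nonzero diagonal slacks, and for `a ≠ a'` one of the
  two cross slacks zero) has `|T| ≤ (|ι| + 1)²` (`FKPT2013_lemma31`; the printed proof verbatim: the
  matrices `z_a t_{w(a)}ᵀ` are linearly independent in the `(|ι|+1)²`-dimensional matrix space).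
  -- TODO(general form): the printed bound is `(dim P + 1)²` with the intrinsic dimension; typed is
  -- the ambient-dimension instance (equal for full-dimensional `P`).
-/

noncomputable section

open Finset Matrix

namespace Literature.Barriers.PneNP

variable {ι : Type} [Fintype ι] {r : ℕ}

/-! ### The fooling-set bound -/

/-- **Fooling sets bound extension complexity.** Let `P` have an extended formulation of size `r`,
let `v_b ∈ P` be points and `c_a · x ≤ d_a` valid inequalities. If the rows `a ∈ T` are each tight
at some `v_b`, and come with points `v_{w(a)}` of positive slack such that for `a ≠ a'` in `T` the
slack of `a` at `v_{w(a')}` or the slack of `a'` at `v_{w(a)}` vanishes (a fooling set in the slack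
matrix), then `|T| ≤ r`. [cite: FioriniKaibelPashkovichTheis2013, §5.3 (fooling sets, ω ≤ rc) and §2 (rc ≤ xc)] -/
theorem HasEFOfSize.card_le_of_foolingSet {P : Set (ι → ℝ)} (h : HasEFOfSize P r) {A B : Type*}
    (v : B → ι → ℝ) (hv : ∀ b, v b ∈ P) (c : A → ι → ℝ) (d : A → ℝ)
    (hvalid : ∀ a, ∀ x ∈ P, c a ⬝ᵥ x ≤ d a) (T : Finset A) (w : A → B)
    (htight : ∀ a ∈ T, ∃ b, c a ⬝ᵥ v b = d a) (hdiag : ∀ a ∈ T, c a ⬝ᵥ v (w a) < d a)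
    (hfool : ∀ a ∈ T, ∀ a' ∈ T, a ≠ a' → c a ⬝ᵥ v (w a') = d a ∨ c a' ⬝ᵥ v (w a) = d a') :
    T.card ≤ r := by
  classical
  obtain ⟨RA₀, RA, RB, h₀, hrect, hcover⟩ := h.exists_cover v hv c d hvalid
  -- each fooling entry lies in a genuine rectangle
  have hex : ∀ a ∈ T, ∃ j, a ∈ RA j ∧ w a ∈ RB j := by
    intro a ha
    rcases hcover a (w a) (hdiag a ha) with h0 | hj
    · obtain ⟨b, hb⟩ := htight a ha
      exact absurd hb (h₀ a h0 b).ne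
    · exact hj
  choose j hjA hjB using hex
  -- and no rectangle holds two of them
  have hinj : Function.Injective (fun a : T => j a.1 a.2) := by
    rintro ⟨a, ha⟩ ⟨a', ha'⟩ hjj
    simp only at hjj
    by_contra hne
    have hne' : a ≠ a' := fun h => hne (Subtype.ext h)
    have h1 : c a ⬝ᵥ v (w a') < d a := hrect (j a ha) a (hjA a ha) (w a') (hjj ▸ hjB a' ha')
    have h2 : c a' ⬝ᵥ v (w a) < d a' := hrect (j a' ha') a' (hjA a' ha') (w a) (hjj ▸ hjB a ha)
    rcases hfool a ha a' ha' hne' with h | h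
    · exact h1.ne h
    · exact h2.ne h
  calc T.card = Fintype.card T := (Fintype.card_coe T).symm
    _ ≤ Fintype.card (Fin r) := Fintype.card_le_of_injective _ hinj
    _ = r := Fintype.card_fin r

/-! ### Proposition 33: the unit cube -/

/-- The unit cube `[0,1]^d ⊆ ℝ^d`. [cite: FioriniKaibelPashkovichTheis2013, §5.3.2 (Prop. 33: "we may assume that P = [0,1]^d")] -/
def unitCube (d : ℕ) : Set (Fin d → ℝ) := Set.Icc 0 1

/-- **`xc([0,1]^d) ≤ 2d`** ("We obviously have … `xc(P) ≤ 2d`"): the slack form `x − y = 0`,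
`x + y' = 1`, `y, y' ≥ 0`. [cite: FioriniKaibelPashkovichTheis2013, Prop. 33 (§5.3.2)] -/
theorem hasEFOfSize_unitCube (d : ℕ) : HasEFOfSize (unitCube d) (2 * d) := by
  classical
  -- rows `Fin d ⊕ Fin d`, slack variables `Fin d ⊕ Fin d`
  let E : Matrix (Fin d ⊕ Fin d) (Fin d) ℝ := fun ρ i => Sum.elim (fun k => if k = i then 1 else 0)
    (fun k => if k = i then 1 else 0) ρ
  let F : Matrix (Fin d ⊕ Fin d) (Fin d ⊕ Fin d) ℝ := fun ρ s =>
    Sum.elim (fun k => Sum.elim (fun l => if k = l then (-1 : ℝ) else 0) (fun _ => 0) s)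
      (fun k => Sum.elim (fun _ => 0) (fun l => if k = l then (1 : ℝ) else 0) s) ρ
  let g : Fin d ⊕ Fin d → ℝ := Sum.elim (fun _ => 0) (fun _ => 1)
  have hsys := hasEFOfSize_of_system (ι := Fin d) E F g
  have hcard : Fintype.card (Fin d ⊕ Fin d) = 2 * d := by simp [two_mul]
  rw [hcard] at hsys
  convert hsys using 1
  ext x
  simp only [unitCube, Set.mem_Icc, Set.mem_setOf_eq]
  have hE : ∀ y : Fin d ⊕ Fin d → ℝ, E *ᵥ x + F *ᵥ y = g ↔
      (∀ k, x k - y (Sum.inl k) = 0) ∧ ∀ k, x k + y (Sum.inr k) = 1 := by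
    intro y
    constructor
    · intro h
      refine ⟨fun k => ?_, fun k => ?_⟩
      · have := congrFun h (Sum.inl k)
        simpa [E, F, g, mulVec, dotProduct, Fintype.sum_sum_type, ite_mul, Finset.sum_ite_eq,
          sub_eq_add_neg] using this
      · have := congrFun h (Sum.inr k)
        simpa [E, F, g, mulVec, dotProduct, Fintype.sum_sum_type, ite_mul, Finset.sum_ite_eq] using this
    · rintro ⟨h1, h2⟩
      funext ρ
      rcases ρ with k | k
      · simpa [E, F, g, mulVec, dotProduct, Fintype.sum_sum_type, ite_mul, Finset.sum_ite_eq,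
          sub_eq_add_neg] using h1 k
      · simpa [E, F, g, mulVec, dotProduct, Fintype.sum_sum_type, ite_mul, Finset.sum_ite_eq] using h2 k
  constructor
  · rintro ⟨h0, h1⟩
    refine ⟨Sum.elim (fun k => x k) (fun k => 1 - x k), ?_, (hE _).2 ⟨fun k => by simp, fun k => by simp⟩⟩
    rintro (k | k)
    · simpa using h0 k
    · simpa [sub_nonneg] using h1 k
  · rintro ⟨y, hy, hsys'⟩
    obtain ⟨h1, h2⟩ := (hE y).1 hsys'
    refine ⟨fun k => ?_, fun k => ?_⟩
    · have := hy (Sum.inl k)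
      have := h1 k
      simp only [Pi.zero_apply]
      linarith
    · have := hy (Sum.inr k)
      have := h2 k
      simp only [Pi.one_apply]
      linarith

/-- **FKPT Proposition 33, for the unit cube: every extended formulation of `[0,1]^d` has at least
`2d` inequalities** (so `xc([0,1]^d) = 2d` with `hasEFOfSize_unitCube`). Proof as printed: the
fooling set `(x_i ≥ 0, v_i)`, `(x_i ≤ 1, w_i)` with the staircase vertices `(v_i)_j = 𝟙[j ≤ i]`,
`(w_i)_j = 𝟙[i < j]`.
-- TODO(general form): the printed Proposition 33 is stated for every combinatorial `d`-cube.
[cite: FioriniKaibelPashkovichTheis2013, Prop. 33 (§5.3.2)] -/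
theorem FKPT2013_prop33 {d r : ℕ} (h : HasEFOfSize (unitCube d) r) : 2 * d ≤ r := by
  classical
  -- rows: `inl i` = `−x_i ≤ 0`, `inr i` = `x_i ≤ 1`; points: `inl i` = `v_i`, `inr i` = `w_i`
  let v : Fin d ⊕ Fin d → Fin d → ℝ :=
    Sum.elim (fun i j => if j ≤ i then (1 : ℝ) else 0) (fun i j => if i < j then (1 : ℝ) else 0)
  let c : Fin d ⊕ Fin d → Fin d → ℝ :=
    Sum.elim (fun i j => if j = i then (-1 : ℝ) else 0) (fun i j => if j = i then (1 : ℝ) else 0)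
  let dd : Fin d ⊕ Fin d → ℝ := Sum.elim (fun _ => 0) (fun _ => 1)
  have hcl : ∀ (i : Fin d) (x : Fin d → ℝ), c (Sum.inl i) ⬝ᵥ x = -x i := by
    intro i x; simp [c, dotProduct, ite_mul, Finset.sum_ite_eq']
  have hcr : ∀ (i : Fin d) (x : Fin d → ℝ), c (Sum.inr i) ⬝ᵥ x = x i := by
    intro i x; simp [c, dotProduct, ite_mul, Finset.sum_ite_eq']
  have hv : ∀ b, v b ∈ unitCube d := by
    rintro (i | i) <;> refine ⟨fun j => ?_, fun j => ?_⟩ <;> simp only [v, Sum.elim_inl, Sum.elim_inr,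
      Pi.zero_apply, Pi.one_apply] <;> split_ifs <;> norm_num
  have hvalid : ∀ a, ∀ x ∈ unitCube d, c a ⬝ᵥ x ≤ dd a := by
    rintro (i | i) x ⟨h0, h1⟩
    · rw [hcl]; simpa [dd] using h0 i
    · rw [hcr]; simpa [dd] using h1 i
  have key := h.card_le_of_foolingSet v hv c dd hvalid univ id ?_ ?_ ?_
  · simpa [two_mul] using key
  · -- every row is tight somewhere: `x_i ≥ 0` at `w_i`, `x_i ≤ 1` at `v_i`
    rintro (i | i) -
    · exact ⟨Sum.inr i, by rw [hcl]; simp [v, dd]⟩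
    · exact ⟨Sum.inl i, by rw [hcr]; simp [v, dd]⟩
  · -- the diagonal entries have positive slack
    rintro (i | i) -
    · rw [hcl]; simp [v, dd]
    · rw [hcr]; simp [v, dd]
  · -- the fooling property
    rintro (i | i) - (i' | i') - hne
    · have hii : (i : ℕ) ≠ i' := fun h => hne (by rw [Fin.ext h])
      simp only [id, hcl, v, dd, Sum.elim_inl, neg_eq_zero, ite_eq_right_iff, one_ne_zero, imp_false,
        not_le]
      omega
    · simp only [id, hcl, hcr, v, dd, Sum.elim_inl, Sum.elim_inr, neg_eq_zero, ite_eq_right_iff,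
        one_ne_zero, imp_false, not_lt, ite_eq_left_iff, not_le, zero_ne_one]
      omega
    · simp only [id, hcl, hcr, v, dd, Sum.elim_inl, Sum.elim_inr, neg_eq_zero, ite_eq_right_iff,
        one_ne_zero, imp_false, not_lt, ite_eq_left_iff, not_le, zero_ne_one]
      omega
    · have hii : (i : ℕ) ≠ i' := fun h => hne (by rw [Fin.ext h])
      simp only [id, hcr, v, dd, Sum.elim_inr, ite_eq_left_iff, not_lt, zero_ne_one, imp_false, not_le]
      omega

/-! ### Proposition 34: the Birkhoff polytope -/

section Birkhoff

variable (α : Type) [DecidableEq α]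

/-- The permutation matrix of `σ`, as a vector indexed by `α × α`: `𝟙[σ i = j]`.
[cite: FioriniKaibelPashkovichTheis2013, §5.3.3 ("the convex hull of all n × n permutation matrices")] -/
def permIndicator (σ : Equiv.Perm α) : α × α → ℝ := fun p => if σ p.1 = p.2 then 1 else 0

/-- **The Birkhoff polytope** `B(α) = conv{permutation matrices} ⊆ ℝ^{α × α}`.
[cite: FioriniKaibelPashkovichTheis2013, §5.3.3] -/
def birkhoffPolytope : Set (α × α → ℝ) := convexHull ℝ (Set.range (permIndicator α))

/-- Permutation matrices are points of the Birkhoff polytope. [cite: FioriniKaibelPashkovichTheis2013, §5.3.3] -/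
theorem permIndicator_mem (σ : Equiv.Perm α) : permIndicator α σ ∈ birkhoffPolytope α :=
  subset_convexHull ℝ _ ⟨σ, rfl⟩

/-- **Birkhoff–von Neumann, in coordinates `α × α`**: `x ∈ B(α)` iff `x ≥ 0` with all row and
column sums `1` ("the set of doubly stochastic matrices or, equivalently, the convex hull of all
permutation matrices"; Mathlib's `doublyStochastic_eq_convexHull_permMatrix`, transported along
currying). [cite: FioriniKaibelPashkovichTheis2013, §5.3.3 (Prop. 34 proof: "defined by the nonnegativity inequalities … and the equations")] -/
theorem mem_birkhoffPolytope_iff [Fintype α] {x : α × α → ℝ} :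
    x ∈ birkhoffPolytope α ↔
      (∀ p, 0 ≤ x p) ∧ (∀ i, ∑ j, x (i, j) = 1) ∧ ∀ j, ∑ i, x (i, j) = 1 := by
  let e : (α × α → ℝ) ≃ₗ[ℝ] (α → α → ℝ) := LinearEquiv.curry ℝ ℝ α α
  have himg : e.toLinearMap '' birkhoffPolytope α = (doublyStochastic ℝ α : Set (Matrix α α ℝ)) := by
    rw [doublyStochastic_eq_convexHull_permMatrix, birkhoffPolytope, e.toLinearMap.image_convexHull]
    congr 1
    ext M
    constructor
    · rintro ⟨_, ⟨σ, rfl⟩, rfl⟩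
      refine ⟨σ, ?_⟩
      ext i j
      simp [e, permIndicator, Equiv.Perm.permMatrix, Equiv.toPEquiv_apply, PEquiv.toMatrix_apply]
    · rintro ⟨σ, rfl⟩
      refine ⟨permIndicator α σ, ⟨σ, rfl⟩, ?_⟩
      ext i j
      simp [e, permIndicator, Equiv.Perm.permMatrix, Equiv.toPEquiv_apply, PEquiv.toMatrix_apply]
  have hmem : x ∈ birkhoffPolytope α ↔ e.toLinearMap x ∈ e.toLinearMap '' birkhoffPolytope α :=
    (Function.Injective.mem_set_image (f := e.toLinearMap) e.injective).symm
  rw [hmem, himg]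
  change (Matrix.of fun i j => x (i, j)) ∈ doublyStochastic ℝ α ↔ _
  rw [mem_doublyStochastic_iff_sum]
  simp only [Matrix.of_apply, Prod.forall]

/-- Points of the Birkhoff polytope are entrywise nonnegative. [cite: FioriniKaibelPashkovichTheis2013, §5.3.3] -/
theorem nonneg_of_mem_birkhoffPolytope [Fintype α] {x : α × α → ℝ} (hx : x ∈ birkhoffPolytope α)
    (p : α × α) :
    0 ≤ x p :=
  ((mem_birkhoffPolytope_iff α).1 hx).1 p

/-- **`xc(B(α)) ≤ |α|²`** ("This trivially implies that `xc(P) ≤ n²`"): the slack form `x − y = 0`,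
row sums `1`, column sums `1`, `y ≥ 0`. [cite: FioriniKaibelPashkovichTheis2013, Prop. 34 (§5.3.3)] -/
theorem hasEFOfSize_birkhoffPolytope [Fintype α] :
    HasEFOfSize (birkhoffPolytope α) (Fintype.card (α × α)) := by
  classical
  -- rows `(α × α) ⊕ α ⊕ α`: `x_p − y_p = 0`, `Σ_j x_{i,j} = 1`, `Σ_i x_{i,j} = 1`
  let E : Matrix ((α × α) ⊕ α ⊕ α) (α × α) ℝ := fun ρ p =>
    Sum.elim (fun q => if q = p then (1 : ℝ) else 0)
      (Sum.elim (fun i => if p.1 = i then (1 : ℝ) else 0) (fun j => if p.2 = j then (1 : ℝ) else 0)) ρ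
  let F : Matrix ((α × α) ⊕ α ⊕ α) (α × α) ℝ := fun ρ p =>
    Sum.elim (fun q => if q = p then (-1 : ℝ) else 0) (fun _ => 0) ρ
  let g : (α × α) ⊕ α ⊕ α → ℝ := Sum.elim (fun _ => 0) (fun _ => 1)
  have hsys := hasEFOfSize_of_system (ι := α × α) E F g
  convert hsys using 1
  ext x
  rw [mem_birkhoffPolytope_iff]
  simp only [Set.mem_setOf_eq]
  have hE : ∀ y : α × α → ℝ, E *ᵥ x + F *ᵥ y = g ↔
      (∀ p, x p - y p = 0) ∧ (∀ i, ∑ j, x (i, j) = 1) ∧ ∀ j, ∑ i, x (i, j) = 1 := by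
    intro y
    have hrow : ∀ i, (∑ p : α × α, (if p.1 = i then (1 : ℝ) else 0) * x p) = ∑ j, x (i, j) := by
      intro i
      rw [Fintype.sum_prod_type, Finset.sum_comm]
      simp only [ite_mul, one_mul, zero_mul, Finset.sum_ite_eq', Finset.mem_univ, if_true]
    have hcol : ∀ j, (∑ p : α × α, (if p.2 = j then (1 : ℝ) else 0) * x p) = ∑ i, x (i, j) := by
      intro j
      rw [Fintype.sum_prod_type]
      simp only [ite_mul, one_mul, zero_mul, Finset.sum_ite_eq', mem_univ, if_true]
    constructor
    · intro h
      refine ⟨fun p => ?_, fun i => ?_, fun j => ?_⟩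
      · have := congrFun h (Sum.inl p)
        simpa [E, F, g, mulVec, dotProduct, ite_mul, Finset.sum_ite_eq, sub_eq_add_neg] using this
      · have := congrFun h (Sum.inr (Sum.inl i))
        simp only [E, F, g, mulVec, dotProduct, Sum.elim_inr, Sum.elim_inl, Pi.add_apply, zero_mul,
          Finset.sum_const_zero, add_zero] at this
        rwa [hrow] at this
      · have := congrFun h (Sum.inr (Sum.inr j))
        simp only [E, F, g, mulVec, dotProduct, Sum.elim_inr, Pi.add_apply, zero_mul,
          Finset.sum_const_zero, add_zero] at this
        rwa [hcol] at this
    · rintro ⟨h1, h2, h3⟩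
      funext ρ
      rcases ρ with p | i | j
      · simpa [E, F, g, mulVec, dotProduct, ite_mul, Finset.sum_ite_eq, sub_eq_add_neg] using h1 p
      · simp only [E, F, g, mulVec, dotProduct, Sum.elim_inr, Sum.elim_inl, Pi.add_apply, zero_mul,
          Finset.sum_const_zero, add_zero]
        rw [hrow]
        exact h2 i
      · simp only [E, F, g, mulVec, dotProduct, Sum.elim_inr, Pi.add_apply, zero_mul,
          Finset.sum_const_zero, add_zero]
        rw [hcol]
        exact h3 j
  constructor
  · rintro ⟨h0, h1, h2⟩
    exact ⟨x, h0, (hE x).2 ⟨fun p => sub_self _, h1, h2⟩⟩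
  · rintro ⟨y, hy, hsys'⟩
    obtain ⟨h1, h2, h3⟩ := (hE y).1 hsys'
    exact ⟨fun p => by have := h1 p; have := hy p; linarith, h2, h3⟩

variable {n : ℕ}

/-- The printed fooling permutation `π_{i,j}` of `ℤ/n`: `π(i) = j`, `π(i+1) = j+1`, and
`π(k) = i+j+1−k` for `k ∉ {i, i+1}` — i.e. `swap(j, j+1) ∘ (k ↦ i+j+1−k)`.
[cite: FioriniKaibelPashkovichTheis2013, Prop. 34 proof (§5.3.3)] -/
def foolPerm (i j : ZMod n) : Equiv.Perm (ZMod n) :=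
  (Equiv.subLeft (i + j + 1)).trans (Equiv.swap j (j + 1))

/-- Unfolding `π_{i,j}`. [cite: FioriniKaibelPashkovichTheis2013, Prop. 34 proof (§5.3.3)] -/
theorem foolPerm_apply (i j k : ZMod n) : foolPerm i j k = Equiv.swap j (j + 1) (i + j + 1 - k) := rfl

/-- `π_{i,j}(i) = j`. [cite: FioriniKaibelPashkovichTheis2013, Prop. 34 proof (§5.3.3)] -/
theorem foolPerm_apply_self (i j : ZMod n) : foolPerm i j i = j := by
  rw [foolPerm_apply, show i + j + 1 - i = j + 1 by ring, Equiv.swap_apply_right]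

/-- `π_{i,j}(i+1) = j+1`. [cite: FioriniKaibelPashkovichTheis2013, Prop. 34 proof (§5.3.3)] -/
theorem foolPerm_apply_succ (i j : ZMod n) : foolPerm i j (i + 1) = j + 1 := by
  rw [foolPerm_apply, show i + j + 1 - (i + 1) = j by ring, Equiv.swap_apply_left]

/-- `π_{i,j}(k) = i+j+1−k` for `k ∉ {i, i+1}`. [cite: FioriniKaibelPashkovichTheis2013, Prop. 34 proof (§5.3.3)] -/
theorem foolPerm_apply_of_ne {i j k : ZMod n} (hk : k ≠ i) (hk' : k ≠ i + 1) :
    foolPerm i j k = i + j + 1 - k := by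
  rw [foolPerm_apply, Equiv.swap_apply_of_ne_of_ne]
  · intro h
    exact hk' (by linear_combination (-1 : ℤ) • h)
  · intro h
    exact hk (by linear_combination (-1 : ℤ) • h)

/-- `2 ≠ 0` in `ℤ/n` for `n ≥ 4` ("Because `2 ≠ 0` … modulo `n`"). [cite: FioriniKaibelPashkovichTheis2013, Prop. 34 proof (§5.3.3)] -/
private theorem two_ne_zero_zmod (hn : 4 ≤ n) : (2 : ZMod n) ≠ 0 := by
  have : ((2 : ℕ) : ZMod n) ≠ 0 := by
    rw [Ne, ZMod.natCast_eq_zero_iff]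
    intro h
    have := Nat.le_of_dvd (by norm_num) h
    omega
  simpa using this

/-- `3 ≠ 0` in `ℤ/n` for `n ≥ 4`. [cite: FioriniKaibelPashkovichTheis2013, Prop. 34 proof (§5.3.3)] -/
private theorem three_ne_zero_zmod (hn : 4 ≤ n) : (3 : ZMod n) ≠ 0 := by
  have : ((3 : ℕ) : ZMod n) ≠ 0 := by
    rw [Ne, ZMod.natCast_eq_zero_iff]
    intro h
    have := Nat.le_of_dvd (by norm_num) h
    omega
  simpa using this

/-- `1 ≠ 0` in `ℤ/n` for `n ≥ 4`. [folklore] -/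
private theorem one_ne_zero_zmod (hn : 4 ≤ n) : (1 : ZMod n) ≠ 0 := by
  haveI : Fact (1 < n) := ⟨by omega⟩
  exact one_ne_zero

/-- **The fooling property of the family `(x_{i,j} ≥ 0, π_{i,j})`**: for `(i,j) ≠ (i',j')` it is not
the case that both `π_{i',j'}(i) = j` and `π_{i,j}(i') = j'` (for `n ≥ 4`).
[cite: FioriniKaibelPashkovichTheis2013, Prop. 34 proof (§5.3.3)] -/
theorem foolPerm_fooling (hn : 4 ≤ n) {i j i' j' : ZMod n} (hne : (i, j) ≠ (i', j'))
    (h1 : foolPerm i' j' i = j) (h2 : foolPerm i j i' = j') : False := by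
  have h2ne := two_ne_zero_zmod hn
  have h3ne := three_ne_zero_zmod hn
  have h1ne := one_ne_zero_zmod hn
  by_cases hii : i = i'
  · subst hii
    rw [foolPerm_apply_self] at h1
    exact hne (by rw [h1])
  by_cases hsucc : i = i' + 1
  · subst hsucc
    rw [foolPerm_apply_succ] at h1
    -- `h2 : π_{i'+1, j}(i') = j'` with `i' ∉ {i'+1, i'+2}`
    rw [foolPerm_apply_of_ne (fun h => h1ne (by linear_combination (-1 : ℤ) • h))
      (fun h => h2ne (by linear_combination (-1 : ℤ) • h))] at h2
    exact h3ne (by linear_combination h1 + h2)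
  · rw [foolPerm_apply_of_ne hii hsucc] at h1
    by_cases hsucc' : i' = i + 1
    · subst hsucc'
      rw [foolPerm_apply_succ] at h2
      exact h3ne (by linear_combination h1 + h2)
    · rw [foolPerm_apply_of_ne (Ne.symm hii) hsucc'] at h2
      exact h2ne (by linear_combination h1 + h2)

/-- **FKPT Proposition 34: for `n ≥ 4`, every extended formulation of the Birkhoff polytope `B(ℤ/n)`
has at least `n²` inequalities** (so `xc = n²` with `hasEFOfSize_birkhoffPolytope`). Proof as printed:
the fooling set `(x_{i,j} ≥ 0, π_{i,j})`, `π_{i,j}(i) = j`.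
[cite: FioriniKaibelPashkovichTheis2013, Prop. 34 (§5.3.3)] -/
theorem FKPT2013_prop34 [NeZero n] (hn : 4 ≤ n) {r : ℕ}
    (h : HasEFOfSize (birkhoffPolytope (ZMod n)) r) : n ^ 2 ≤ r := by
  classical
  -- rows: the nonnegativity inequalities `−x_{i,j} ≤ 0`; points: the permutation matrices
  let c : ZMod n × ZMod n → ZMod n × ZMod n → ℝ := fun a p => if p = a then (-1 : ℝ) else 0
  have hc : ∀ a (x : ZMod n × ZMod n → ℝ), c a ⬝ᵥ x = -x a := by
    intro a x
    simp [c, dotProduct, ite_mul, Finset.sum_ite_eq']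
  have hval : ∀ (σ : Equiv.Perm (ZMod n)) (a : ZMod n × ZMod n),
      c a ⬝ᵥ permIndicator (ZMod n) σ = if σ a.1 = a.2 then -1 else 0 := by
    intro σ a
    rw [hc]
    simp only [permIndicator]
    split_ifs <;> simp
  have key := h.card_le_of_foolingSet (permIndicator (ZMod n)) (permIndicator_mem (ZMod n)) c
    (fun _ => 0) (fun a x hx => by rw [hc]; linarith [nonneg_of_mem_birkhoffPolytope (ZMod n) hx a])
    univ (fun a => foolPerm a.1 a.2) ?_ ?_ ?_
  · simpa [ZMod.card, sq] using key
  · -- every row `x_{i,j} ≥ 0` is tight at a permutation with `σ(i) ≠ j`: `σ = (j − i + 1) + ·`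
    rintro ⟨i, j⟩ -
    refine ⟨Equiv.addLeft (j - i + 1), ?_⟩
    rw [hval, if_neg]
    simp only [Equiv.coe_addLeft]
    intro h
    exact one_ne_zero_zmod hn (by linear_combination h)
  · rintro ⟨i, j⟩ -
    rw [hval, if_pos (foolPerm_apply_self i j)]
    norm_num
  · rintro ⟨i, j⟩ - ⟨i', j'⟩ - hne
    rw [hval, hval]
    simp only [ite_eq_right_iff, neg_eq_zero, one_ne_zero, imp_false]
    by_contra hboth
    push Not at hboth
    exact foolPerm_fooling hn hne hboth.1 hboth.2

end Birkhoff


/-! ### Lemma 31: fooling sets are at most quadratic in the dimension -/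

/-- **Fiorini–Kaibel–Pashkovich–Theis 2013, Lemma 31 (ambient form): fooling sets have size at most
`(dimension + 1)²`.** Let `c_a · x ≤ d_a` (`a ∈ A`) be rows and `v_b` (`b ∈ B`) points of `ℝ^ι`, and
let `T` be a finite set of rows with chosen columns `w(a)` such that the diagonal slacks
`d_a − c_a · v_{w(a)}` are nonzero and, for `a ≠ a'` in `T`, one of the cross slacks
`d_a − c_a · v_{w(a')}`, `d_{a'} − c_{a'} · v_{w(a)}` vanishes. Then `|T| ≤ (|ι| + 1)²`. Proof as printed:
with `z_a = (d_a, −c_a)`, `t_b = (1, v_b)` in `ℝ^{|ι|+1}`, the rank-one matrices `z_a t_{w(a)}ᵀ`, `a ∈ T`,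
are linearly independent, since pairing with `t_{w(a')} z_{a'}ᵀ` gives
`⟨z_a, t_{w(a')}⟩⟨z_{a'}, t_{w(a)}⟩`, zero off the diagonal and nonzero on it.
[cite: FioriniKaibelPashkovichTheis2013, Lemma 31 (§5.3) and its proof] -/
theorem FKPT2013_lemma31 {A B : Type*} (v : B → ι → ℝ) (c : A → ι → ℝ) (d : A → ℝ)
    (T : Finset A) (w : A → B) (hdiag : ∀ a ∈ T, c a ⬝ᵥ v (w a) ≠ d a)
    (hfool : ∀ a ∈ T, ∀ a' ∈ T, a ≠ a' → c a ⬝ᵥ v (w a') = d a ∨ c a' ⬝ᵥ v (w a) = d a') :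
    T.card ≤ (Fintype.card ι + 1) ^ 2 := by
  classical
  -- `z_a = (d_a, −c_a)`, `t_b = (1, v_b)` on the index set `Option ι` (`none` = the extra coordinate)
  let z : A → Option ι → ℝ := fun a o => o.elim (d a) fun i => -c a i
  let t : B → Option ι → ℝ := fun b o => o.elim 1 fun i => v b i
  -- the slack as the pairing `⟨z_a, t_b⟩`
  have hpair : ∀ a b, ∑ o, z a o * t b o = d a - c a ⬝ᵥ v b := by
    intro a b
    rw [Fintype.sum_option]
    simp only [z, t, Option.elim, mul_one, dotProduct, neg_mul]
    rw [Finset.sum_neg_distrib, sub_eq_add_neg]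
  -- the matrices `N_a = z_a t_{w(a)}ᵀ` as vectors of `ℝ^{(|ι|+1)²}`
  let N : A → (Option ι × Option ι → ℝ) := fun a pq => z a pq.1 * t (w a) pq.2
  -- pairing `N_a` against `t_{w(a')} z_{a'}ᵀ`
  have hNN : ∀ a a', ∑ pq : Option ι × Option ι, N a pq * (t (w a') pq.1 * z a' pq.2) =
      (d a - c a ⬝ᵥ v (w a')) * (d a' - c a' ⬝ᵥ v (w a)) := by
    intro a a'
    rw [← hpair a (w a'), ← hpair a' (w a), Fintype.sum_prod_type, Finset.sum_mul_sum]
    refine Finset.sum_congr rfl fun p _ => Finset.sum_congr rfl fun q _ => ?_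
    simp only [N]
    ring
  -- linear independence of `(N_a)_{a ∈ T}`
  have hli : LinearIndependent ℝ (fun a : T => N a.1) := by
    rw [linearIndependent_iff']
    intro s g hg a ha
    have h := congr_arg (fun F : Option ι × Option ι → ℝ => ∑ pq, F pq * (t (w a.1) pq.1 * z a.1 pq.2)) hg
    simp only [Finset.sum_apply, Pi.smul_apply, smul_eq_mul, Pi.zero_apply, zero_mul,
      Finset.sum_const_zero] at h
    simp_rw [Finset.sum_mul] at h
    rw [Finset.sum_comm] at h
    have hterms : ∀ a' ∈ s, ∑ pq : Option ι × Option ι, g a' * N a'.1 pq * (t (w a.1) pq.1 * z a.1 pq.2) =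
        if a' = a then g a * (d a.1 - c a.1 ⬝ᵥ v (w a.1)) ^ 2 else 0 := by
      intro a' _
      have : ∑ pq : Option ι × Option ι, g a' * N a'.1 pq * (t (w a.1) pq.1 * z a.1 pq.2) =
          g a' * ((d a'.1 - c a'.1 ⬝ᵥ v (w a.1)) * (d a.1 - c a.1 ⬝ᵥ v (w a'.1))) := by
        rw [← hNN a'.1 a.1, Finset.mul_sum]
        exact Finset.sum_congr rfl fun pq _ => by ring
      rw [this]
      split_ifs with haa
      · subst haa; ring
      · have hne : a'.1 ≠ a.1 := fun h => haa (Subtype.ext h)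
        rcases hfool a'.1 a'.2 a.1 a.2 hne with h0 | h0
        · -- `c a' · v (w a) = d a'`: the first factor vanishes
          rw [h0, sub_self, zero_mul, mul_zero]
        · rw [h0, sub_self, mul_zero, mul_zero]
    rw [Finset.sum_congr rfl hterms, Finset.sum_ite_eq' s a, if_pos ha] at h
    have hs : (d a.1 - c a.1 ⬝ᵥ v (w a.1)) ^ 2 ≠ 0 := pow_ne_zero 2 (sub_ne_zero.2 (Ne.symm (hdiag a.1 a.2)))
    exact (mul_eq_zero.1 h).resolve_right hs
  have hcard := hli.fintype_card_le_finrank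
  rw [Module.finrank_fintype_fun_eq_card, Fintype.card_prod, Fintype.card_option,
    Fintype.card_coe] at hcard
  simpa [sq] using hcard

end Literature.Barriers.PneNP
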